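import Literature.Probability.Percolation.KozmaNitzanClusterProperty
import HarnessLib

/-!
# Kozma–Nitzan (2024), Lemma 3(i) for a `{0,1}`-valued monotone cluster property — PROVED

Topic `Literature/Probability/Percolation`.  Source: G. Kozma, S. Nitzan, *A reduction of the `θ(p_c) = 0`
problem to a conjectured inequality*, arXiv:2401.12397 (2024) [KozmaNitzan2024], Lemma 3 (pp. 6–7) with §5.1
(pp. 31–32, monotone cluster properties).  Companion of `KozmaNitzanClusterProperty.lean`, which proves the
cluster-property form of Lemma 3(ii) (`KozmaNitzan2024_lemma3_ii_cluster`); this file adds part (i) along the same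
printed route, using the event forms of BHK 2006 Thm. 1.3 / 1.4 already in the tree
(`KNPreFKG.bhk_one_upper_upper`, `KNPreFKG.bhk_two_upper_upper`).  No definition and no named fact is introduced.

## Printed statement (read: `lit read arxiv:2401.12397`, pp. 6–7, 31)

**Lemma 3** (p. 6): "Let `G` be a graph, `a₁, a₂, b ∈ G` and `δ > 0` be such that `P(a₁ ↔ b) < P(a₂ ↔ b) + δ`.
(i) If `Q` is an increasing event in the cluster of `a₂` then we have `P(a₁ ↔ b | Q) < P(a₂ ↔ b | Q) + δ`."
Printed proof (pp. 6–7): remove the common part `P(a₁ ↔ a₂ ↔ b)`, condition on `{a₁ ↮ a₂}`, "apply lemma 1(i)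
to the right hand side and lemma 1(ii) to the left hand side" (= BHK given `{a₁ ↮ a₂}`), multiply back; the
`δ`-term is where FKG enters in print.  §5.1 (p. 31) replaces `𝟙{· ↔ b}` by a monotone cluster property.

## What is proved here

For a monotone predicate `P` on vertex sets (the `{0,1}`-valued monotone cluster properties, as in
`KozmaNitzanClusterProperty.lean`) and `Q = {C_{a₂} ∈ 𝒬}` with `𝒬` an UPPER family of edge sets: if
`P(P(C(a₁))) ≤ P(P(C(a₂))) + δ`, `δ ≥ 0`, then `P(P(C(a₁)), Q) ≤ P(P(C(a₂)), Q) + δ` — the JOINT (denominator-free)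
form, which needs no FKG: on `{a₁ ↔ a₂}` the two events coincide; on `D = {a₁ ↮ a₂}`,
`P(D)·P(P(C a₁), Q, D) ≤ P(P(C a₁), D)·P(Q, D)` (BHK Thm. 1.4, increasing in `C_{a₁}` × increasing in `C_{a₂}`),
`≤ (P(P(C a₂), D) + δ)·P(Q, D) ≤ P(D)·(P(P(C a₂), Q, D) + δ)` (BHK Thm. 1.3 in `C_{a₂}`, and `P(Q,D) ≤ P(D)`).
The printed conditional form follows on dividing by `P(Q)` when `δ = 0`.  Corollary with `Q = {a₂ ↔ B}`
(`KozmaNitzan2024_lemma3_i_cluster_conn`), the form used by the one-layer floor-split inequality of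
`Summit.CriticalPhenomena.PercolationContinuityZ3` (crux stmt-CriticalPhenomena-4575).
-/

noncomputable section

open MeasureTheory Set
open Literature.Probability.LatticeModels (prodBernoulli)

namespace Literature.Probability.Percolation

variable {V : Type*} [Fintype V]

open KNPreFKG

/-- **Kozma–Nitzan 2024, Lemma 3(i), for a `{0,1}`-valued monotone cluster property, joint form** (pp. 6–7
with §5.1, p. 31): if `P` is a monotone predicate on vertex sets, `P(P(C(a₁))) ≤ P(P(C(a₂))) + δ` with `δ ≥ 0`,
and `Q = {C_{a₂} ∈ 𝒬}` is an increasing event in the (edge) cluster of `a₂`, then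
`P(P(C(a₁)), Q) ≤ P(P(C(a₂)), Q) + δ`.  Proof as printed for `{aᵢ ↔ b}`: on `{a₁ ↔ a₂}` the two events coincide
(same cluster); on `D = {a₁ ↮ a₂}`, BHK Thm. 1.4 (increasing in `C_{a₁}` × increasing in `C_{a₂}`) and Thm. 1.3
(increasing × increasing in `C_{a₂}`); no FKG is needed in the joint form.
[cite: KozmaNitzan2024, Lemma 3(i) (pp. 6–7) and §5.1 (p. 31)] -/
theorem KozmaNitzan2024_lemma3_i_cluster (w : Sym2 V → unitInterval) (a₁ a₂ : V) (P : Set V → Prop)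
    (hP : ∀ S T : Set V, S ⊆ T → P S → P T) {δ : ℝ} (hδ : 0 ≤ δ)
    (h : (prodBernoulli w).real {ω | P (openCluster ω a₁)} ≤
      (prodBernoulli w).real {ω | P (openCluster ω a₂)} + δ)
    {𝒬 : Set (Set (Sym2 V))} (h𝒬 : IsUpperSet 𝒬) :
    (prodBernoulli w).real ({ω | P (openCluster ω a₁)} ∩ {ω | openEdgeCluster ω a₂ ∈ 𝒬}) ≤
      (prodBernoulli w).real ({ω | P (openCluster ω a₂)} ∩ {ω | openEdgeCluster ω a₂ ∈ 𝒬}) + δ := by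
  classical
  set μ := prodBernoulli w with hμ
  set X₁ : Set (BondConfig V) := {ω | P (openCluster ω a₁)} with hX₁
  set X₂ : Set (BondConfig V) := {ω | P (openCluster ω a₂)} with hX₂
  set Q : Set (BondConfig V) := {ω | openEdgeCluster ω a₂ ∈ 𝒬} with hQ
  by_cases h12 : a₁ = a₂
  · subst h12
    linarith [h]
  set D : Set (BondConfig V) := {ω | ¬ (openGraph ω).Reachable a₁ a₂} with hD
  -- on `Dᶜ` the two events agree (same cluster)
  have hagree : X₁ ∩ Dᶜ = X₂ ∩ Dᶜ := by
    ext ω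
    simp only [mem_inter_iff, mem_compl_iff, mem_setOf_eq, not_not, hX₁, hX₂, hD]
    constructor
    · rintro ⟨h1, h2⟩
      exact ⟨by rwa [← openCluster_eq_of_reachable h2], h2⟩
    · rintro ⟨h1, h2⟩
      exact ⟨by rwa [openCluster_eq_of_reachable h2], h2⟩
  -- split every event along `D`
  have hsplit : ∀ A : Set (BondConfig V), μ.real A = μ.real (A ∩ D) + μ.real (A ∩ Dᶜ) := by
    intro A
    rw [← measureReal_inter_add_sdiff (s := A) (MeasurableSet.of_discrete : MeasurableSet D),
      Set.sdiff_eq]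
  -- the hypothesis restricted to `D`
  have hH : μ.real (D ∩ X₁) ≤ μ.real (D ∩ X₂) + δ := by
    have h' := h
    rw [hsplit X₁, hsplit X₂, hagree] at h'
    rw [inter_comm D X₁, inter_comm D X₂]
    linarith
  -- the events in edge-cluster form
  have hX₁e : X₁ = {ω | openEdgeCluster ω a₁ ∈ {C : Set (Sym2 V) | P {a | a = a₁ ∨ ∃ e ∈ C, a ∈ e}}} :=
    setOf_prop_openCluster_eq a₁ P
  have hX₂e : X₂ = {ω | openEdgeCluster ω a₂ ∈ {C : Set (Sym2 V) | P {a | a = a₂ ∨ ∃ e ∈ C, a ∈ e}}} :=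
    setOf_prop_openCluster_eq a₂ P
  -- (1) two-cluster BHK (Thm. 1.4): `s = a₁`, `t = a₂`, increasing `X₁` in `C_{a₁}`, increasing `Q` in `C_{a₂}`
  have h1 := bhk_two_upper_upper w a₁ a₂ h12 (isUpperSet_clusterPropFamily a₁ P hP) h𝒬
  rw [← hX₁e] at h1
  -- (3) one-cluster BHK (Thm. 1.3): `s = a₂`, `X = {a₁}`, increasing `X₂`, increasing `Q`, both in `C_{a₂}`
  have hD2 : {ω : BondConfig V | ∀ x ∈ ({a₁} : Set V), ¬ (openGraph ω).Reachable a₂ x} = D := by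
    ext ω
    simp only [mem_setOf_eq, hD, mem_singleton_iff, forall_eq]
    exact not_congr ⟨SimpleGraph.Reachable.symm, SimpleGraph.Reachable.symm⟩
  have h3 := bhk_one_upper_upper w a₂ ({a₁} : Set V) (by simpa using Ne.symm h12)
    (isUpperSet_clusterPropFamily a₂ P hP) h𝒬
  rw [hD2, ← hX₂e] at h3
  have hQD : μ.real (D ∩ Q) ≤ μ.real D := measureReal_mono inter_subset_left
  -- the inequality on `D`
  have hcore : μ.real (X₁ ∩ Q ∩ D) ≤ μ.real (X₂ ∩ Q ∩ D) + δ := by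
    rw [inter_comm (X₁ ∩ Q) D, inter_comm (X₂ ∩ Q) D]
    by_cases hD0 : μ.real D = 0
    · have h0 : μ.real (D ∩ (X₁ ∩ Q)) = 0 :=
        le_antisymm ((measureReal_mono inter_subset_left).trans hD0.le) measureReal_nonneg
      rw [h0]
      exact add_nonneg measureReal_nonneg hδ
    · have hDpos : 0 < μ.real D := lt_of_le_of_ne measureReal_nonneg (Ne.symm hD0)
      have hchain : μ.real D * μ.real (D ∩ (X₁ ∩ Q)) ≤
          μ.real D * (μ.real (D ∩ (X₂ ∩ Q)) + δ) := by
        calc μ.real D * μ.real (D ∩ (X₁ ∩ Q))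
            ≤ μ.real (D ∩ X₁) * μ.real (D ∩ Q) := h1
          _ ≤ (μ.real (D ∩ X₂) + δ) * μ.real (D ∩ Q) :=
              mul_le_mul_of_nonneg_right hH measureReal_nonneg
          _ = μ.real (D ∩ X₂) * μ.real (D ∩ Q) + δ * μ.real (D ∩ Q) := by ring
          _ ≤ μ.real D * μ.real (D ∩ (X₂ ∩ Q)) + δ * μ.real D :=
              add_le_add h3 (mul_le_mul_of_nonneg_left hQD hδ)
          _ = μ.real D * (μ.real (D ∩ (X₂ ∩ Q)) + δ) := by ring
      exact le_of_mul_le_mul_left hchain hDpos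
  -- conclude by adding the parts on `Dᶜ`, where the events coincide
  have hagreeQ : X₁ ∩ Q ∩ Dᶜ = X₂ ∩ Q ∩ Dᶜ := by
    rw [inter_right_comm, hagree, inter_right_comm]
  calc μ.real (X₁ ∩ Q) = μ.real (X₁ ∩ Q ∩ D) + μ.real (X₁ ∩ Q ∩ Dᶜ) := hsplit _
    _ ≤ μ.real (X₂ ∩ Q ∩ D) + δ + μ.real (X₂ ∩ Q ∩ Dᶜ) := by
        rw [hagreeQ]
        linarith [hcore]
    _ = μ.real (X₂ ∩ Q) + δ := by
        rw [hsplit (X₂ ∩ Q)]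
        ring

/-- **Lemma 3(i) for a monotone cluster property, with `δ = 0` and `Q = {a₂ ↔ B}`**: if
`P(P(C(a₁))) ≤ P(P(C(a₂)))` then `P(P(C(a₁)), a₂ ↔ B) ≤ P(P(C(a₂)), a₂ ↔ B)` for every vertex set `B`
(`{a₂ ↔ B} = {∃ u ∈ B, a₂ ↔ u}` is increasing and read on `C_{a₂}`).
[cite: KozmaNitzan2024, Lemma 3(i) (pp. 6–7) and §5.1 (p. 31)] -/
theorem KozmaNitzan2024_lemma3_i_cluster_conn (w : Sym2 V → unitInterval) (a₁ a₂ : V)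
    (P : Set V → Prop) (hP : ∀ S T : Set V, S ⊆ T → P S → P T) (B : Set V)
    (h : (prodBernoulli w).real {ω | P (openCluster ω a₁)} ≤
      (prodBernoulli w).real {ω | P (openCluster ω a₂)}) :
    (prodBernoulli w).real ({ω | P (openCluster ω a₁)} ∩
        {ω | ∃ u ∈ B, (openGraph ω).Reachable a₂ u}) ≤
      (prodBernoulli w).real ({ω | P (openCluster ω a₂)} ∩
        {ω | ∃ u ∈ B, (openGraph ω).Reachable a₂ u}) := by
  have hup : IsUpperSet (disconnFamily a₂ B)ᶜ := (isLowerSet_disconnFamily a₂ B).compl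
  have key := KozmaNitzan2024_lemma3_i_cluster w a₁ a₂ P hP le_rfl (by simpa using h) hup
  have hev : {ω : BondConfig V | ∃ u ∈ B, (openGraph ω).Reachable a₂ u} =
      {ω | openEdgeCluster ω a₂ ∈ (disconnFamily a₂ B)ᶜ} := by
    have e := setOf_forall_not_reachable_eq a₂ B
    ext ω
    have := congrArg (fun S : Set (BondConfig V) => ω ∈ S) e
    simp only [mem_setOf_eq, eq_iff_iff] at this
    simp only [mem_setOf_eq, mem_compl_iff, ← this]
    push Not
    rfl
  rw [← hev, add_zero] at key
  exact key

end Literature.Probability.Percolation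

end
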